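import Mathlib
import Summits.KontsevichZagierPeriods.Zeta5Search.BigPrimeNineWindow
import HarnessLib.Audit
import HarnessLib

/-!
# `F̃₉(b)` below `b₀`, the RESIDUAL PRIMES: (W)₉♯ at `p = 7`, (U)₉♯ at `p = 5` — all slot conjectures are THEOREMS

Cell `pub-zeta5` (HONEST FRAMING: systematic search; no irrationality claim unless certified).  Provenance: written
by the family-designer seat `pub-zeta5-fam-vwp-g13` (planner role, no stage permission; staged for the cell's lane),
`families/vwp/FAMILY.md` §21.  Bookkeeping of OUR linear forms (`k = 9`); nothing here concerns irrationality, and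
nothing here is new mathematics about ζ(5).

WHAT WAS LEFT.  `BigPrimeNineWindow` proves the sharp windows (W)₉♯ / (U)₉♯ / (S)₉♯ below `b₀` by the level-2
dual polynomial `M2` and the Lucas-type power-sum count `BigPrime.sum_taylor_coeff_eq_zero`
(`Σ_{x ∈ 𝔽_p} [X^r] M(X + x) = 0` for `r < p`, `deg M < r + (r + 1)(p − 1)`), read at the index `r = 9 − o + …`,
i.e. `r = 7` for `coeff3` and `r = 5` for `coeff5`.  At the smallest primes of the windows, `p = 7` resp. `p = 5`,
the read index EQUALS `p` and that count is not available (`bigPrime9Zeta3Sharp_iff_seven`,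
`bigPrime9Zeta5Sharp_iff_five` isolate exactly these instances).

THE NEW INPUT (§1).  At the critical index `r = p` the count acquires one extra term: writing `M = Σ_k W^k h_k` in base
`W = X^p − X` (`deg h_k < p`), `Σ_x [X^p] M(X + x) = [X^{p−1}] h_p − [X^{p−1}] h_1`.  If `M` vanishes to SECOND order
at every point of `𝔽_p` then `W² ∣ M`, so `h_1 = 0`, and the sum vanishes as soon as `deg M < p² + p − 1`.  In Lean
we avoid the `W`-adic expansion: for `M = W² · N` one has `[X^p] M(X + x) = [X^{p−2}] N(X + x)` (because
`W² = X² (X^{p−1} − 1)²` is translation invariant, `taylor_X_pow_card_sub_X`), and the OLD count applies to `N` at the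
index `p − 2 < p` (`sum_taylor_coeff_card_eq_zero`).  Second-order vanishing of `M2` at every point (§2,
`X_sq_dvd_taylor_M2`): off the image of the support block it vanishes to order `8` (`X_pow_eight_dvd_taylor_M2`),
and at a support point `−q` BOTH rim complements `KC (rimL …)`, `KC (rimR …)` vanish (the argument of `z2_cast`),
which is where the threshold `b₀ + 1 ≤ p + b_{j₂} + b_{j₃}` is used.  Degrees (§3): `natDegree_M2_le` gives
`deg M2 + 8b₀ + 7 ≤ 10p + 2Σb_j`, and on the window (`p ≤ d₉ + 2`, resp. `2p ≤ d₉ + 2`, with `d₉ = 4b₀ − Σ b_j`) this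
is `deg M2 ≤ 53 < 55 = 7² + 7 − 1` at `p = 7` and `deg M2 ≤ 27 < 29` at `p = 5`.

CONSEQUENCES (§4): `bigPrime9Zeta3Sharp_holds : BigPrime9Zeta3Sharp`, `bigPrime9Zeta5Sharp_holds : BigPrime9Zeta5Sharp`
(13c, sharp ends `d₉ + 2`), hence the gen-4 conjecture nodes `DualSeriesNineMinors.BigPrime9Zeta3` / `BigPrime9Zeta5`
(`bigPrime9Zeta3_holds`, `bigPrime9Zeta5_holds`, via `of_sharp`); with `BigPrimeNineWindow.bigPrime9Zeta7(Sharp)_holds`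
ALL of (W)₉ / (U)₉ / (S)₉ and their sharpenings are theorems.  Numerical cross-check of §1–§3 before formalisation:
`pub-zeta5-fam-vwp/g13/residual_identity_check.py` (identity on 60 random polynomials; `W² ∣ M2`, the degree bound and
the vanishing power sum on all 2,644 admissible slot multisets at `p = 7` and all 416 at `p = 5`: "ALL OK").
-/

noncomputable section

open Finset Polynomial

namespace Summit.KontsevichZagierPeriods.Zeta5Search.BigPrimeNine

open Summit.KontsevichZagierPeriods.Zeta5Search.DualSeriesNine (InBox coeff3 coeff5 coeff3_eq coeff5_eq
  exists_isPFData9 IsPFData9)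
open Summit.KontsevichZagierPeriods.Zeta5Search.DualSeriesNineMinors (dNine BigPrime9Zeta3 BigPrime9Zeta5
  BigPrime9Zeta7)
open Summit.KontsevichZagierPeriods.Zeta5Search.BigPrime (block block_subset sum_taylor_coeff_eq_zero
  one_le_padicValRat_of_eq coeff_eq_of_X_pow_dvd_sub taylor_prod' taylor_X_add_C KC rimL rimR prod_univ_X_add_C
  taylor_X_pow_card_sub_X)

/-! ### 1. The power-sum count at the critical index `r = p` -/

section Critical

variable {p : ℕ} [hp : Fact p.Prime]

/-- `deg (X^p − X) = p` over `𝔽_p`. -/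
theorem natDegree_X_pow_card_sub_X' : (X ^ p - X : (ZMod p)[X]).natDegree = p := by
  have hlt : (X : (ZMod p)[X]).natDegree < ((X : (ZMod p)[X]) ^ p).natDegree := by
    rw [natDegree_X_pow, natDegree_X]; exact hp.out.one_lt
  rw [natDegree_sub_eq_left_of_natDegree_lt hlt, natDegree_X_pow]

/-- `X^p − X ≠ 0` over `𝔽_p`. -/
theorem X_pow_card_sub_X_ne_zero' : (X ^ p - X : (ZMod p)[X]) ≠ 0 := fun h => by
  have h' := natDegree_X_pow_card_sub_X' (p := p)
  rw [h, natDegree_zero] at h'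
  exact hp.out.ne_zero h'.symm

/-- For `M = (X^p − X)² · N`: `[X^p] M(X + x) = [X^{p−2}] N(X + x)` — the square `(X^p − X)² = X² (X^{p−1} − 1)²` is
translation invariant and `(X^{p−1} − 1)² ≡ 1 (mod X^{p−1})`. -/
theorem taylor_coeff_card_of_sq_mul (N : (ZMod p)[X]) (x : ZMod p) :
    (taylor x ((X ^ p - X) ^ 2 * N)).coeff p = (taylor x N).coeff (p - 2) := by
  have h2 : 2 ≤ p := hp.out.two_le
  rw [taylor_mul, taylor_pow, taylor_X_pow_card_sub_X]
  have hXp : (X ^ p - X : (ZMod p)[X]) ^ 2 = X ^ 2 * ((X ^ (p - 1) - 1) ^ 2) := by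
    have h : (X : (ZMod p)[X]) ^ p = X * X ^ (p - 1) := by
      rw [← pow_succ', Nat.sub_add_cancel hp.out.one_le]
    rw [h]; ring
  have hdvd : (X : (ZMod p)[X]) ^ (p - 1) ∣ (X ^ (p - 1) - 1) ^ 2 * taylor x N - taylor x N :=
    ⟨(X ^ (p - 1) - 2) * taylor x N, by ring⟩
  rw [hXp, mul_assoc, coeff_X_pow_mul', if_pos h2]
  exact coeff_eq_of_X_pow_dvd_sub hdvd (by omega)

/-- **Power sums at the critical index `r = p`.**  If `(X^p − X)² ∣ M` and
`deg M < 2p + ((p − 2) + (p − 1)(p − 1)) = p² + p − 1`, then `Σ_{x ∈ 𝔽_p} [X^p] M(X + x) = 0`.  (At `r = p` the count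
`sum_taylor_coeff_eq_zero` is unavailable; second-order vanishing on all of `𝔽_p` is what replaces `r < p`.) -/
theorem sum_taylor_coeff_card_eq_zero (M : (ZMod p)[X]) (hM : (X ^ p - X) ^ 2 ∣ M)
    (hdeg : M.natDegree < 2 * p + ((p - 2) + (p - 2 + 1) * (p - 1))) :
    ∑ x : ZMod p, (taylor x M).coeff p = 0 := by
  obtain ⟨N, rfl⟩ := hM
  simp_rw [taylor_coeff_card_of_sq_mul]
  by_cases hN : N = 0
  · simp [hN]
  refine sum_taylor_coeff_eq_zero N (p - 2) (by have := hp.out.two_le; omega) ?_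
  have hMdeg : ((X ^ p - X : (ZMod p)[X]) ^ 2 * N).natDegree = 2 * p + N.natDegree := by
    rw [natDegree_mul (pow_ne_zero _ X_pow_card_sub_X_ne_zero') hN, natDegree_pow, natDegree_X_pow_card_sub_X']
  rw [hMdeg] at hdeg
  omega

/-- A polynomial over `𝔽_p` vanishing to second order at EVERY point of `𝔽_p` is divisible by `(X^p − X)²`. -/
theorem X_pow_card_sub_X_sq_dvd (M : (ZMod p)[X]) (h : ∀ x : ZMod p, X ^ 2 ∣ taylor x M) :
    (X ^ p - X) ^ 2 ∣ M := by
  rw [← prod_univ_X_add_C, ← prod_pow]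
  apply Finset.prod_dvd_of_coprime
  · intro u _ v _ huv
    have hcop : IsCoprime (X - C (-u)) (X - C (-v)) :=
      pairwise_coprime_X_sub_C (s := fun w : ZMod p => -w) (fun a b hab => neg_inj.1 hab) huv
    rw [C_neg, C_neg, sub_neg_eq_add, sub_neg_eq_add] at hcop
    exact hcop.pow
  · intro u _
    obtain ⟨Q, hQ⟩ := h (-u)
    refine ⟨taylor u Q, ?_⟩
    have hM : M = taylor u (taylor (-u) M) := by rw [taylor_taylor, add_neg_cancel, taylor_zero]
    rw [hM, hQ, taylor_mul, taylor_pow, taylor_X]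

end Critical

/-! ### 2. `M2` vanishes to second order at every point of `𝔽_p` -/

section Vanishing

variable {p : ℕ} [hp : Fact p.Prime]

/-- `X² ∣ M2(X + x)` for EVERY `x ∈ 𝔽_p`: off the image of the support block `M2` vanishes to order `8`
(`X_pow_eight_dvd_taylor_M2`); at a support point `−q` each of the two rim complements contributes one factor `X`
(the rims miss `q` modulo `p` because `b₀ + 1 ≤ p + b_{j₂} + b_{j₃}`). -/
theorem X_sq_dvd_taylor_M2 {n : ℕ} {β : ℕ → ℕ} {j₁ j₂ j₃ : ℕ} (hj₁ : j₁ ∈ range 9)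
    (hj₂ : j₂ ∈ (range 9).erase j₁) (hT : n + 1 ≤ p + β j₂ + β j₃) (h23 : β j₂ ≤ β j₃) (h3 : 2 * β j₃ ≤ n)
    (hmin : ∀ j ∈ ((range 9).erase j₁).erase j₂, β j₃ ≤ β j) (x : ZMod p) :
    (X : (ZMod p)[X]) ^ 2 ∣ taylor x (M2 p n β j₁ j₂ j₃) := by
  by_cases hx : x ∈ (block n (β j₃)).image fun q : ℕ => -((q : ℕ) : ZMod p)
  · obtain ⟨q, hq, hqx⟩ := mem_image.1 hx
    have hq' := hq
    rw [block, mem_Icc] at hq'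
    set r : ZMod p := -((q : ℕ) : ZMod p) with hr
    have hXL : (X : (ZMod p)[X]) ∣ taylor r (KC p (rimL (β j₂) (β j₃))) := by
      have hmem : -r ∈ univ \ (rimL (β j₂) (β j₃)).image (Nat.cast : ℕ → ZMod p) := by
        rw [mem_sdiff]; refine ⟨mem_univ _, fun h => ?_⟩
        obtain ⟨s, hs, hsq⟩ := mem_image.1 h
        rw [rimL, mem_Ico] at hs
        rw [hr, neg_neg] at hsq
        have hm := (ZMod.natCast_eq_natCast_iff s q p).1 hsq
        have := hm.eq_of_abs_lt (by rw [abs_lt]; constructor <;> omega)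
        omega
      rw [KC, taylor_prod']
      have hfac : taylor r (X + C (-r)) = X := by rw [taylor_X_add_C, neg_add_cancel, C_0, add_zero]
      exact (dvd_of_eq hfac.symm).trans (Finset.dvd_prod_of_mem (fun u : ZMod p => taylor r (X + C u)) hmem)
    have hXR : (X : (ZMod p)[X]) ∣ taylor r (KC p (rimR n (β j₂) (β j₃))) := by
      have hmem : -r ∈ univ \ (rimR n (β j₂) (β j₃)).image (Nat.cast : ℕ → ZMod p) := by
        rw [mem_sdiff]; refine ⟨mem_univ _, fun h => ?_⟩
        obtain ⟨s, hs, hsq⟩ := mem_image.1 h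
        rw [rimR, mem_Ioc] at hs
        rw [hr, neg_neg] at hsq
        have hm := (ZMod.natCast_eq_natCast_iff s q p).1 hsq
        have := hm.eq_of_abs_lt (by rw [abs_lt]; constructor <;> omega)
        omega
      rw [KC, taylor_prod']
      have hfac : taylor r (X + C (-r)) = X := by rw [taylor_X_add_C, neg_add_cancel, C_0, add_zero]
      exact (dvd_of_eq hfac.symm).trans (Finset.dvd_prod_of_mem (fun u : ZMod p => taylor r (X + C u)) hmem)
    rw [← hqx, M2, taylor_mul, taylor_mul, taylor_mul, taylor_mul, taylor_mul, pow_two]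
    exact ((mul_dvd_mul hXL hXR).mul_left _).mul_left _
  · exact (pow_dvd_pow X (by norm_num : 2 ≤ 8)).trans (X_pow_eight_dvd_taylor_M2 hj₁ hj₂ hmin x hx)

/-- Hence `(X^p − X)² ∣ M2`. -/
theorem X_pow_card_sub_X_sq_dvd_M2 {n : ℕ} {β : ℕ → ℕ} {j₁ j₂ j₃ : ℕ} (hj₁ : j₁ ∈ range 9)
    (hj₂ : j₂ ∈ (range 9).erase j₁) (hT : n + 1 ≤ p + β j₂ + β j₃) (h23 : β j₂ ≤ β j₃) (h3 : 2 * β j₃ ≤ n)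
    (hmin : ∀ j ∈ ((range 9).erase j₁).erase j₂, β j₃ ≤ β j) :
    ((X : (ZMod p)[X]) ^ p - X) ^ 2 ∣ M2 p n β j₁ j₂ j₃ :=
  X_pow_card_sub_X_sq_dvd _ fun x => X_sq_dvd_taylor_M2 hj₁ hj₂ hT h23 h3 hmin x

end Vanishing

/-! ### 3. The residual primes: (W)₉∞ at `p = 7` and (U)₉∞ at `p = 5`, glued to the windows `p ≥ 11` / `p ≥ 7` -/

/-- (W)₉∞ at level 2, cleared form, for ALL `p ≥ 7` (`b₀ + 1 ≤ p + b_{j₂} + b_{j₃}`, `p ≤ d₉ + 2`): `p ≥ 11` is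
`exists_clear_coeff3_of_slots`; at `p = 7` the power sum is read at the critical index `7 = p`
(`sum_taylor_coeff_card_eq_zero`, `deg M2 ≤ 53 < 55`). -/
theorem exists_clear_coeff3_of_slots' (b : ℕ → ℤ) (p j₁ j₂ j₃ : ℕ) (hb : InBox b)
    (h2 : ∀ i ∈ range 9, 2 * b (i + 1) ≤ b 0) (h4 : ∑ i ∈ range 9, b (i + 1) ≤ 4 * b 0)
    (hj₁ : j₁ ∈ range 9) (hj₂ : j₂ ∈ range 9) (hj₃ : j₃ ∈ range 9) (h12 : j₂ ≠ j₁)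
    (hle : b (j₂ + 1) ≤ b (j₃ + 1)) (hmin : ∀ j ∈ range 9, j ≠ j₁ → j ≠ j₂ → b (j₃ + 1) ≤ b (j + 1))
    (hprime : p.Prime) (hp7 : 7 ≤ p) (hpT : b 0 + 1 ≤ (p : ℤ) + b (j₂ + 1) + b (j₃ + 1))
    (hpd : (p : ℤ) ≤ dNine b + 2) :
    ∃ U Z : ℤ, ¬ (p : ℤ) ∣ U ∧ (p : ℤ) ∣ Z ∧ (U : ℚ) * coeff3 b = Z := by
  by_cases hp11 : 11 ≤ p
  · exact exists_clear_coeff3_of_slots b p j₁ j₂ j₃ hb h2 h4 hj₁ hj₂ hj₃ h12 hle hmin hprime hp11 hpT hpd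
  have hlt : p < 11 := by omega
  obtain rfl : p = 7 := by
    interval_cases p
    · rfl
    all_goals exact absurd hprime (by decide)
  haveI : Fact (Nat.Prime 7) := ⟨hprime⟩
  obtain ⟨e0, hS, hβ⟩ := polytope_data b hb h2
  obtain ⟨hj₂', h23, hmin', hT', hS', h3'⟩ := slot_data b hb h2 hj₂ hj₃ h12 hle hmin hpT
  have hpd' : 7 + ∑ j ∈ range 9, (b (j + 1)).toNat ≤ 4 * (b 0).toNat + 2 := by
    have := hpd; rw [dNine, hS, e0] at this; omega
  have hhalf : ∀ j ∈ range 9, 2 * b (j + 1) ≤ b 0 + 1 := fun j hj => by have := h2 j hj; omega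
  obtain ⟨c, hc⟩ := exists_isPFData9 b hb (by omega)
  refine ⟨_, _, not_dvd_U2all hprime hT' h23, ?_,
    by rw [coeff3_eq hc]; exact U2all_mul_sum_eq b hb hhalf hc hj₁ hj₂' h23 hmin' (by norm_num) (by norm_num : 2 < 8)⟩
  rw [← ZMod.intCast_zmod_eq_zero_iff_dvd, Z2sum_cast hj₁ hj₂' hS' hT' h23 h3' hmin' (by norm_num : 5 < 6) (by omega),
    sum_taylor_coeff_card_eq_zero (M2 7 (b 0).toNat (fun j => (b (j + 1)).toNat) j₁ j₂ j₃)
      (X_pow_card_sub_X_sq_dvd_M2 hj₁ hj₂' hT' h23 h3' hmin') ?_, mul_zero]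
  have := natDegree_M2_le (p := 7) hj₁ hj₂' hS' hT' h23 hmin' hβ h3'
  beta_reduce at this
  omega

/-- (U)₉∞ at level 2, cleared form, for ALL `p ≥ 5` (`b₀ + 1 ≤ p + b_{j₂} + b_{j₃}`, `2p ≤ d₉ + 2`): `p ≥ 7` is
`exists_clear_coeff5_of_slots`; at `p = 5` the critical-index count applies (`deg M2 ≤ 27 < 29`). -/
theorem exists_clear_coeff5_of_slots' (b : ℕ → ℤ) (p j₁ j₂ j₃ : ℕ) (hb : InBox b)
    (h2 : ∀ i ∈ range 9, 2 * b (i + 1) ≤ b 0) (h4 : ∑ i ∈ range 9, b (i + 1) ≤ 4 * b 0)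
    (hj₁ : j₁ ∈ range 9) (hj₂ : j₂ ∈ range 9) (hj₃ : j₃ ∈ range 9) (h12 : j₂ ≠ j₁)
    (hle : b (j₂ + 1) ≤ b (j₃ + 1)) (hmin : ∀ j ∈ range 9, j ≠ j₁ → j ≠ j₂ → b (j₃ + 1) ≤ b (j + 1))
    (hprime : p.Prime) (hp5 : 5 ≤ p) (hpT : b 0 + 1 ≤ (p : ℤ) + b (j₂ + 1) + b (j₃ + 1))
    (hpd : 2 * (p : ℤ) ≤ dNine b + 2) :
    ∃ U Z : ℤ, ¬ (p : ℤ) ∣ U ∧ (p : ℤ) ∣ Z ∧ (U : ℚ) * coeff5 b = Z := by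
  by_cases hp7 : 7 ≤ p
  · exact exists_clear_coeff5_of_slots b p j₁ j₂ j₃ hb h2 h4 hj₁ hj₂ hj₃ h12 hle hmin hprime hp7 hpT hpd
  have hlt : p < 7 := by omega
  obtain rfl : p = 5 := by
    interval_cases p
    · rfl
    all_goals exact absurd hprime (by decide)
  haveI : Fact (Nat.Prime 5) := ⟨hprime⟩
  obtain ⟨e0, hS, hβ⟩ := polytope_data b hb h2
  obtain ⟨hj₂', h23, hmin', hT', hS', h3'⟩ := slot_data b hb h2 hj₂ hj₃ h12 hle hmin hpT
  have hpd' : 2 * 5 + ∑ j ∈ range 9, (b (j + 1)).toNat ≤ 4 * (b 0).toNat + 2 := by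
    have := hpd; rw [dNine, hS, e0] at this; omega
  have hhalf : ∀ j ∈ range 9, 2 * b (j + 1) ≤ b 0 + 1 := fun j hj => by have := h2 j hj; omega
  obtain ⟨c, hc⟩ := exists_isPFData9 b hb (by omega)
  refine ⟨_, _, not_dvd_U2all hprime hT' h23, ?_,
    by rw [coeff5_eq hc]; exact U2all_mul_sum_eq b hb hhalf hc hj₁ hj₂' h23 hmin' (by norm_num) (by norm_num : 4 < 8)⟩
  rw [← ZMod.intCast_zmod_eq_zero_iff_dvd, Z2sum_cast hj₁ hj₂' hS' hT' h23 h3' hmin' (by norm_num : 3 < 6) (by omega),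
    sum_taylor_coeff_card_eq_zero (M2 5 (b 0).toNat (fun j => (b (j + 1)).toNat) j₁ j₂ j₃)
      (X_pow_card_sub_X_sq_dvd_M2 hj₁ hj₂' hT' h23 h3' hmin') ?_, mul_zero]
  have := natDegree_M2_le (p := 5) hj₁ hj₂' hS' hT' h23 hmin' hβ h3'
  beta_reduce at this
  omega

/-- **(W)₉∞ ON THE WHOLE SHARP WINDOW.**  Let `b` lie in the polytope (`2b_j ≤ b₀`, `Σ b_j ≤ 4b₀`); drop a slot `j₁`,
let `j₂ ≠ j₁` be a slot with `b_{j₂} ≤ b_{j₃}` and `j₃` one with `b_{j₃} ≤ b_j` for all `j ∉ {j₁, j₂}`.  Then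
EVERY prime `p ≥ 7` with `b₀ + 1 − b_{j₂} − b_{j₃} ≤ p ≤ d₉(b) + 2` has `v_p(coeff3 b) ≥ 1` (if `coeff3 b ≠ 0`) —
including the residual prime `p = 7` of `BigPrimeNineWindow`. -/
theorem one_le_padicValRat_coeff3_of_slots' (b : ℕ → ℤ) (p j₁ j₂ j₃ : ℕ) (hb : InBox b)
    (h2 : ∀ i ∈ range 9, 2 * b (i + 1) ≤ b 0) (h4 : ∑ i ∈ range 9, b (i + 1) ≤ 4 * b 0)
    (hj₁ : j₁ ∈ range 9) (hj₂ : j₂ ∈ range 9) (hj₃ : j₃ ∈ range 9) (h12 : j₂ ≠ j₁)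
    (hle : b (j₂ + 1) ≤ b (j₃ + 1)) (hmin : ∀ j ∈ range 9, j ≠ j₁ → j ≠ j₂ → b (j₃ + 1) ≤ b (j + 1))
    (hprime : p.Prime) (hp7 : 7 ≤ p) (hpT : b 0 + 1 ≤ (p : ℤ) + b (j₂ + 1) + b (j₃ + 1))
    (hpd : (p : ℤ) ≤ dNine b + 2) (h3 : coeff3 b ≠ 0) : 1 ≤ padicValRat p (coeff3 b) := by
  haveI : Fact p.Prime := ⟨hprime⟩
  obtain ⟨U, Z, hU, hZ, hUW⟩ :=
    exists_clear_coeff3_of_slots' b p j₁ j₂ j₃ hb h2 h4 hj₁ hj₂ hj₃ h12 hle hmin hprime hp7 hpT hpd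
  exact one_le_padicValRat_of_eq hUW hU hZ h3

/-- **(U)₉∞ ON THE WHOLE SHARP WINDOW**: same slots, EVERY prime `p ≥ 5` with `b₀ + 1 ≤ p + b_{j₂} + b_{j₃}` and
`2p ≤ d₉(b) + 2` has `v_p(coeff5 b) ≥ 1` — including the residual prime `p = 5`. -/
theorem one_le_padicValRat_coeff5_of_slots' (b : ℕ → ℤ) (p j₁ j₂ j₃ : ℕ) (hb : InBox b)
    (h2 : ∀ i ∈ range 9, 2 * b (i + 1) ≤ b 0) (h4 : ∑ i ∈ range 9, b (i + 1) ≤ 4 * b 0)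
    (hj₁ : j₁ ∈ range 9) (hj₂ : j₂ ∈ range 9) (hj₃ : j₃ ∈ range 9) (h12 : j₂ ≠ j₁)
    (hle : b (j₂ + 1) ≤ b (j₃ + 1)) (hmin : ∀ j ∈ range 9, j ≠ j₁ → j ≠ j₂ → b (j₃ + 1) ≤ b (j + 1))
    (hprime : p.Prime) (hp5 : 5 ≤ p) (hpT : b 0 + 1 ≤ (p : ℤ) + b (j₂ + 1) + b (j₃ + 1))
    (hpd : 2 * (p : ℤ) ≤ dNine b + 2) (h5 : coeff5 b ≠ 0) : 1 ≤ padicValRat p (coeff5 b) := by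
  haveI : Fact p.Prime := ⟨hprime⟩
  obtain ⟨U, Z, hU, hZ, hUW⟩ :=
    exists_clear_coeff5_of_slots' b p j₁ j₂ j₃ hb h2 h4 hj₁ hj₂ hj₃ h12 hle hmin hprime hp5 hpT hpd
  exact one_le_padicValRat_of_eq hUW hU hZ h5

/-! ### 4. Consequences for the conjecture nodes: (W)₉♯, (U)₉♯, (W)₉, (U)₉ are theorems -/

/-- **(W)₉♯ IS A THEOREM**: the sharpened node `BigPrime9Zeta3Sharp` (13c: `p ≥ 7`, `b₀ + 1 − b_{j₂} − b_{j₃} ≤ p`,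
`p ≤ d₉ + 2`) holds — it is literally `one_le_padicValRat_coeff3_of_slots'`. -/
theorem bigPrime9Zeta3Sharp_holds : BigPrime9Zeta3Sharp :=
  fun b p j₁ j₂ j₃ hb h2 h4 hj₁ hj₂ hj₃ hne hle hmin hp hp7 hL hpd h0 =>
    one_le_padicValRat_coeff3_of_slots' b p j₁ j₂ j₃ hb h2 h4 hj₁ hj₂ hj₃ hne hle hmin hp hp7 hL hpd h0

/-- **(U)₉♯ IS A THEOREM**: the sharpened node `BigPrime9Zeta5Sharp` (13c: `p ≥ 5`, `b₀ + 1 − b_{j₂} − b_{j₃} ≤ p`,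
`2p ≤ d₉ + 2`) holds — it is literally `one_le_padicValRat_coeff5_of_slots'`. -/
theorem bigPrime9Zeta5Sharp_holds : BigPrime9Zeta5Sharp :=
  fun b p j₁ j₂ j₃ hb h2 h4 hj₁ hj₂ hj₃ hne hle hmin hp hp5 hL hpd h0 =>
    one_le_padicValRat_coeff5_of_slots' b p j₁ j₂ j₃ hb h2 h4 hj₁ hj₂ hj₃ hne hle hmin hp hp5 hL hpd h0

/-- **(W)₉ IS A THEOREM**: the gen-4 conjecture node `DualSeriesNineMinors.BigPrime9Zeta3` (window `p ≤ d₉ + 1`)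
follows from its sharpening (`of_sharp`, 13c). -/
theorem bigPrime9Zeta3_holds : BigPrime9Zeta3 := of_sharp.1 bigPrime9Zeta3Sharp_holds

/-- **(U)₉ IS A THEOREM**: the gen-4 conjecture node `DualSeriesNineMinors.BigPrime9Zeta5` (window `2p ≤ d₉ + 1`)
follows from its sharpening (`of_sharp`, 13c). -/
theorem bigPrime9Zeta5_holds : BigPrime9Zeta5 := of_sharp.2.1 bigPrime9Zeta5Sharp_holds

/-- The instances singled out by `BigPrimeNineWindow` are now settled: the right-hand sides of
`bigPrime9Zeta3Sharp_iff_seven` and `bigPrime9Zeta5Sharp_iff_five` hold. -/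
theorem residual_instances :
    (∀ (b : ℕ → ℤ) (j₁ j₂ j₃ : ℕ), InBox b → (∀ i ∈ range 9, 2 * b (i + 1) ≤ b 0) →
      ∑ i ∈ range 9, b (i + 1) ≤ 4 * b 0 → j₁ ∈ range 9 → j₂ ∈ range 9 → j₃ ∈ range 9 → j₂ ≠ j₁ →
      b (j₂ + 1) ≤ b (j₃ + 1) → (∀ j ∈ range 9, j ≠ j₁ → j ≠ j₂ → b (j₃ + 1) ≤ b (j + 1)) →
      b 0 + 1 ≤ (7 : ℤ) + b (j₂ + 1) + b (j₃ + 1) → (7 : ℤ) ≤ dNine b + 2 →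
      coeff3 b ≠ 0 → 1 ≤ padicValRat 7 (coeff3 b)) ∧
    (∀ (b : ℕ → ℤ) (j₁ j₂ j₃ : ℕ), InBox b → (∀ i ∈ range 9, 2 * b (i + 1) ≤ b 0) →
      ∑ i ∈ range 9, b (i + 1) ≤ 4 * b 0 → j₁ ∈ range 9 → j₂ ∈ range 9 → j₃ ∈ range 9 → j₂ ≠ j₁ →
      b (j₂ + 1) ≤ b (j₃ + 1) → (∀ j ∈ range 9, j ≠ j₁ → j ≠ j₂ → b (j₃ + 1) ≤ b (j + 1)) →
      b 0 + 1 ≤ (5 : ℤ) + b (j₂ + 1) + b (j₃ + 1) → 2 * (5 : ℤ) ≤ dNine b + 2 →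
      coeff5 b ≠ 0 → 1 ≤ padicValRat 5 (coeff5 b)) :=
  ⟨bigPrime9Zeta3Sharp_iff_seven.1 bigPrime9Zeta3Sharp_holds, bigPrime9Zeta5Sharp_iff_five.1 bigPrime9Zeta5Sharp_holds⟩

/-- Arithmetic of the two critical degree counts (kernel check of the numbers quoted in the module docstring only):
at `p = 7`, `10p + 2Σβ − 8n − 7 ≤ 53 < 55 = 2p + ((p−2) + (p−1)²)` when `p + Σβ ≤ 4n + 2`; at `p = 5`, `≤ 27 < 29`. -/
example : 2 * 7 + ((7 - 2) + (7 - 2 + 1) * (7 - 1)) = 55 ∧ 2 * 5 + ((5 - 2) + (5 - 2 + 1) * (5 - 1)) = 29 ∧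
    (∀ n S : ℕ, 7 + S ≤ 4 * n + 2 → 10 * 7 + 2 * S ≤ 53 + (8 * n + 7)) ∧
    (∀ n S : ℕ, 2 * 5 + S ≤ 4 * n + 2 → 10 * 5 + 2 * S ≤ 27 + (8 * n + 7)) := by
  refine ⟨by norm_num, by norm_num, fun n S h => by omega, fun n S h => by omega⟩

end Summit.KontsevichZagierPeriods.Zeta5Search.BigPrimeNine

end
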